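import Summits.RiemannHypothesis.RiemannHypothesis.Theses.WeilComb
import Literature.NumberTheory.LFunctions.WeilExplicit
import Literature.NumberTheory.LFunctions.WeilArchimedeanMoments
import Literature.NumberTheory.LFunctions.WeilMellinBounds
import Literature.NumberTheory.LFunctions.WeilWindowSimpleEven
import Literature.NumberTheory.LFunctions.WeilMarkovQuadratic
import Literature.NumberTheory.LFunctions.WeilGroundEnergyProofs
import Literature.NumberTheory.LFunctions.WeilSmallSupportPositivity

/-!
# Stub `stub_archDiag` of line `helson-dirichlet-slack` for crux `WeilComb.CombSubcritical`
(item stmt-RiemannHypothesis-1025, route route-RiemannHypothesis-WeilComb)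

Sharp diagonal coercivity of the archimedean term of Weil's functional (Bombieri 2000, Thm. 12,
without the `log log(1/b)` loss): there is an absolute constant `C` (we take `C = 7`) such that
`Re W_∞(g ⋆ g̃) ≥ (log(1/b) − C) ‖g‖₂²` for every Weil test function `g` with
`tsupport g ⊆ [-b, b]`, `0 < b ≤ 1`.

Proof. `Re W_∞(g ⋆ g̃) = (1/2π) ∫ |ĝ(1/2+iu)|² ρ(u) du − (log π) ‖g‖₂²` with
`ρ(u) = Re ψ(1/4 + iu/2)` (`weilArchIntegral_weilConv_weilReflect`,
`weilConv_weilReflect_apply_zero`). The weight has the everywhere-valid minorant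
`σ(u) = max(ψ₀, log|u| − 5)`, `ψ₀ = −4.22745354 ≤ ψ(1/4) ≤ ρ(u)`: for `|u| < 2`,
`log|u| − 5 ≤ log 2 − 5 ≤ ψ₀`, and for `|u| ≥ 2`, `log|u| − 5 ≤ log|u| − 1.9786 ≤ L_{|u|} ≤ ρ(u)`
(`weilLevel_bounds`, `weilLevel_le_reDigammaQuarter`); so `∫ |ĝ|² σ ≤ ∫ |ĝ|² ρ` by the minorant
principle `integral_norm_sq_weilMellin_mul_mono`. Next, with `c = log(1/b) ≥ 0`,
`L = ‖g‖₁`, `G(u) = |ĝ(1/2+iu)|² ≤ L²` (`norm_weilMellin_half_line_le`) and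
`ℓ = 1_{(-1/b, 1/b]} · (c − log|u|) ≥ 0`, one has POINTWISE
`(c − 5) G(u) − L² ℓ(u) ≤ G(u) σ(u)` (off the interval `log|u| ≥ c`; on it
`L² ℓ ≥ G ℓ` and `(c − 5) − (c − log|u|) = log|u| − 5 ≤ σ`; at `u = 0`, where `log 0 = 0`, the
same computation applies verbatim). Integrating (`integral_norm_sq_weilMellin_half_line`:
`∫ G = 2π ‖g‖₂²`; `integral_log`: `∫ ℓ = 2/b`; `weilNorm1_sq_le`: `L² ≤ 2b ‖g‖₂²`) gives
`∫ |ĝ|² ρ ≥ 2π (c − 5) ‖g‖₂² − 4 ‖g‖₂²`, whence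
`Re W_∞(g ⋆ g̃) ≥ (c − 5 − 2/π − log π) ‖g‖₂² ≥ (c − 7) ‖g‖₂²` (`π > 3`, `log π ≤ 1.1447299`).
-/

noncomputable section

open scoped BigOperators ComplexConjugate
open Complex MeasureTheory Set

namespace Summit.RiemannHypothesis.RiemannHypothesis.Theorems.WeilCombSubcritical

open Literature.NumberTheory.LFunctions

/-- **Stub 5 — sharp diagonal coercivity** (Bombieri 2000 Thm 12 WITHOUT the `log log` loss):
an absolute `C` with `Re W_∞(g ⋆ g̃) ≥ (log(1/b) − C)‖g‖₂²` for every Weil test `g` supported in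
`[-b, b]`, `0 < b ≤ 1`. -/
theorem stub_archDiag :
    ∃ C : ℝ, ∀ g : ℝ → ℂ, IsWeilTest g → ∀ b : ℝ, 0 < b → b ≤ 1 → tsupport g ⊆ Set.Icc (-b) b →
      (Real.log (1 / b) - C) * weilNorm2Sq g ≤ (weilArchTerm (weilConv g (weilReflect g))).re := by
  refine ⟨7, fun g hg b hb hb1 hsupp ↦ ?_⟩
  -- numerical constants
  have hl2 := Real.log_two_lt_d9
  have hlpi := Literature.Analysis.SpecialFunctions.Real.log_pi_le
  have hpi3 := Real.pi_gt_three
  have hπ0 : 0 < Real.pi := Real.pi_pos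
  -- notation
  set N := weilNorm2Sq g with hN
  have hN0 : 0 ≤ N := weilNorm2Sq_nonneg g
  set L := weilNorm1 g with hL
  set G : ℝ → ℝ := fun u ↦ ‖weilMellin g (1 / 2 + u * I)‖ ^ 2 with hG
  have hGi : Integrable G := integrable_norm_sq_weilMellin_half_line hg
  have hPl : ∫ u, G u = 2 * Real.pi * N := integral_norm_sq_weilMellin_half_line hg
  have hGL : ∀ u, G u ≤ L ^ 2 := fun u ↦
    pow_le_pow_left₀ (norm_nonneg _) (norm_weilMellin_half_line_le hg u) 2
  have hG0 : ∀ u, 0 ≤ G u := fun u ↦ by positivity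
  set A : ℝ := ∫ t : ℝ, ‖weilMellin g (1 / 2 + t * I)‖ ^ 2 *
    (Complex.digamma (1 / 4 + t / 2 * I)).re with hA
  -- Step 1: the archimedean term of `g ⋆ g̃` is `(1/2π) A − N log π`
  have harch : (weilArchTerm (weilConv g (weilReflect g))).re =
      1 / (2 * Real.pi) * A - N * Real.log Real.pi := by
    have e : weilArchTerm (weilConv g (weilReflect g)) =
        ((1 / (2 * Real.pi) * A - N * Real.log Real.pi : ℝ) : ℂ) := by
      unfold weilArchTerm
      rw [weilArchIntegral_weilConv_weilReflect hg, weilConv_weilReflect_apply_zero, ← hA,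
        show (∫ t : ℝ, ‖g t‖ ^ 2) = N from rfl]
      push_cast
      ring
    rw [e, Complex.ofReal_re]
  -- Step 2: the minorant `σ = max(ψ₀, log|u| - 5) ≤ ρ`
  set σ : ℝ → ℝ := fun u ↦ max (-4.22745354) (Real.log |u| - 5) with hσ
  have hσm : Measurable σ :=
    measurable_const.max ((Real.measurable_log.comp measurable_abs).sub_const 5)
  have hσb : ∀ u, |σ u| ≤ 5 + 1 * u ^ 2 := by
    intro u
    have h1 : Real.log |u| ≤ |u| := Real.log_le_self (abs_nonneg u)
    have h2 : |u| ≤ 1 + u ^ 2 := by nlinarith [abs_nonneg u, sq_abs u]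
    have h3 : (-4.22745354 : ℝ) ≤ σ u := le_max_left _ _
    have h4 : σ u ≤ 1 + u ^ 2 := max_le (by nlinarith [sq_nonneg u]) (by linarith)
    rw [abs_le]
    constructor <;> nlinarith [sq_nonneg u]
  have hσle : ∀ u, σ u ≤ Literature.Analysis.SpecialFunctions.reDigammaQuarter u := by
    intro u
    have hρ0 : (-4.22745354 : ℝ) ≤ Literature.Analysis.SpecialFunctions.reDigammaQuarter u := by
      have h0 := Literature.Analysis.SpecialFunctions.re_digamma_one_quarter_ge
      have h1 := Literature.Analysis.SpecialFunctions.reDigammaQuarter_zero_le u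
      rw [Literature.Analysis.SpecialFunctions.reDigammaQuarter_zero] at h1
      linarith
    refine max_le hρ0 ?_
    rcases lt_or_ge |u| 2 with hu2 | hu2
    · have hlog : Real.log |u| ≤ Real.log 2 := by
        rcases eq_or_ne u 0 with rfl | hu
        · rw [abs_zero, Real.log_zero]
          exact Real.log_nonneg one_le_two
        · exact Real.log_le_log (abs_pos.2 hu) hu2.le
      linarith
    · have h1 := (weilLevel_bounds hu2).1
      have h2 := weilLevel_le_reDigammaQuarter hu2 le_rfl
      linarith
  have hGσi : Integrable fun u ↦ G u * σ u :=
    integrable_norm_sq_weilMellin_mul hg hσm (A := 5) (B := 1) (by norm_num) (by norm_num) hσb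
  have hmono : ∫ u, G u * σ u ≤ A :=
    integral_norm_sq_weilMellin_mul_mono hg hσm (A := 5) (B := 1) (by norm_num) (by norm_num)
      hσb hσle
  -- Step 3: the integrable minorant `h = (c - 5) G - L² ℓ ≤ G σ`
  set c := Real.log (1 / b) with hc
  have hb' : 0 < 1 / b := by positivity
  have hb1' : 1 ≤ 1 / b := by rw [le_div_iff₀ hb]; linarith
  have hc0 : 0 ≤ c := Real.log_nonneg hb1'
  have hab : -(1 / b) ≤ 1 / b := by linarith
  set S := Ioc (-(1 / b)) (1 / b) with hS
  set ℓ : ℝ → ℝ := S.indicator (fun u ↦ c - Real.log |u|) with hℓ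
  set h : ℝ → ℝ := fun u ↦ (c - 5) * G u - L ^ 2 * ℓ u with hh
  have hpt : ∀ u, h u ≤ G u * σ u := by
    intro u
    have hσu : G u * (Real.log |u| - 5) ≤ G u * σ u :=
      mul_le_mul_of_nonneg_left (le_max_right _ _) (hG0 u)
    by_cases hu : u ∈ S
    · have hℓu : ℓ u = c - Real.log |u| := indicator_of_mem hu _
      have habs : |u| ≤ 1 / b := abs_le.2 ⟨hu.1.le, hu.2⟩
      have hlog : Real.log |u| ≤ c := by
        rcases eq_or_ne u 0 with rfl | hu0
        · rwa [abs_zero, Real.log_zero]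
        · exact Real.log_le_log (abs_pos.2 hu0) habs
      have h1 : G u * (c - Real.log |u|) ≤ L ^ 2 * (c - Real.log |u|) :=
        mul_le_mul_of_nonneg_right (hGL u) (by linarith)
      simp only [hh, hℓu]
      linarith
    · have hℓu : ℓ u = 0 := indicator_of_notMem hu _
      have habs : 1 / b ≤ |u| := by
        simp only [hS, mem_Ioc, not_and_or, not_lt, not_le] at hu
        rcases hu with hu | hu
        · rw [abs_of_nonpos (by linarith)]
          linarith
        · exact hu.le.trans (le_abs_self u)
      have hlog : c ≤ Real.log |u| := Real.log_le_log hb' habs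
      have h1 : G u * c ≤ G u * Real.log |u| := mul_le_mul_of_nonneg_left hlog (hG0 u)
      simp only [hh, hℓu, mul_zero, sub_zero]
      linarith
  -- integrability and the value of `∫ ℓ = 2/b`
  have hlogi : IntervalIntegrable (fun u ↦ c - Real.log |u|) volume (-(1 / b)) (1 / b) := by
    simp_rw [Real.log_abs]
    exact intervalIntegrable_const.sub intervalIntegral.intervalIntegrable_log'
  have hℓint : Integrable ℓ := hlogi.1.integrable_indicator measurableSet_Ioc
  have hIval : ∫ u in (-(1 / b))..(1 / b), (c - Real.log |u|) = 2 / b := by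
    simp_rw [Real.log_abs]
    rw [intervalIntegral.integral_sub intervalIntegrable_const
      intervalIntegral.intervalIntegrable_log', intervalIntegral.integral_const, integral_log,
      smul_eq_mul, Real.log_neg_eq_log, hc]
    ring
  have hℓval : ∫ u, ℓ u = 2 / b := by
    rw [hℓ, integral_indicator measurableSet_Ioc, ← intervalIntegral.integral_of_le hab, hIval]
  have hhi : Integrable h := (hGi.const_mul (c - 5)).sub (hℓint.const_mul (L ^ 2))
  have hhval : ∫ u, h u = (c - 5) * (2 * Real.pi * N) - L ^ 2 * (2 / b) := by
    simp only [hh]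
    rw [integral_sub (hGi.const_mul _) (hℓint.const_mul _), integral_const_mul,
      integral_const_mul, hPl, hℓval]
  have hmono2 : ∫ u, h u ≤ ∫ u, G u * σ u := integral_mono hhi hGσi hpt
  -- `L² · (2/b) ≤ 4 N`
  have hL2 : L ^ 2 ≤ 2 * b * N := weilNorm1_sq_le hg hb hsupp
  have hL2' : L ^ 2 * (2 / b) ≤ 4 * N := by
    calc L ^ 2 * (2 / b) ≤ 2 * b * N * (2 / b) := mul_le_mul_of_nonneg_right hL2 (by positivity)
      _ = 4 * N := by field_simp; ring
  -- Step 4: assemble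
  have hAge : (c - 5) * (2 * Real.pi * N) - 4 * N ≤ A := by linarith
  rw [harch]
  have h2π : 1 / (2 * Real.pi) * ((c - 5) * (2 * Real.pi * N) - 4 * N) ≤
      1 / (2 * Real.pi) * A := mul_le_mul_of_nonneg_left hAge (by positivity)
  have e : 1 / (2 * Real.pi) * ((c - 5) * (2 * Real.pi * N) - 4 * N) =
      (c - 5) * N - 2 / Real.pi * N := by
    field_simp
    ring
  rw [e] at h2π
  have h2pi : 2 / Real.pi ≤ 2 / 3 := div_le_div_of_nonneg_left (by norm_num) (by norm_num) hpi3.le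
  have hcoef : 0 ≤ 2 - 2 / Real.pi - Real.log Real.pi := by linarith
  have hprod := mul_nonneg hcoef hN0
  nlinarith [hprod, h2π]

end Summit.RiemannHypothesis.RiemannHypothesis.Theorems.WeilCombSubcritical

end
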